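import Summits.QuantumFields.YangMills.Theorems.BalabanUVNodesK0RecordFormatNamesP0C

/-!
# NODE O port PT-A — `G3CAtRecord F`: THE LOCATED GAP G-P6 AS A UNIVERSAL DISPLAYED LETTER over the P0-ℂ body `P0CarrierClauses` (✓ DEF-1 ed.23): the RESUMMED generalized random walk
# expansion of the resolvent member of [16] (63) — «Summing the expressions with the same localization X» (24)–(25) for `G̃₃(x) = (x + T)⁻¹` at the record's complex, field-localized carrier —
# i.e. what the v3.3 stub `stub_G3C : ∀ F, G3CAtRecord F` of 27930's line `pta_residueW` asserts, and what the glue `lzdetHalf_of_P0C_G3C` reads (director-ym №548 (iii); ◆ CRIT-1 g37 (Q-ord) G-1)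

Cell `ym-nodeO-ideate`, porter seat `ymgap-nodeO-port-PTA-1` (gen 7); DEFINITION file (a displayed letter the line posits), `--supports stmt-QuantumFields-27930`.  [16] = [Balaban1985UV3],
[B9] = [Balaban1985BackgroundPropagators], [B4] = [Balaban1984PropagatorsI], [I] = [Balaban1987RG1].

WHY.  In v3.3 of the skeleton the Gaussian sub-half `PortRecordLZdetHalf` is closed by THREE pieces: `stub_P0C : ∀ F, P0HolExtAtRecord F` (the complex carrier `TC = Σ_Y TY` with its integer twin,
germ agreement, covariance, Schur decay, real and complex coercivity — DEF-1's letter over this seat's typed body), `stub_G3C : ∀ F, G3CAtRecord F` (THIS file), and the glue.  The glue applies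
(63) on the FINITE interval `[0, R]` (✓`B10LogDet63.matrix63` ∕ `diff61_split`), `R = 2γ₁'` chosen AFTER the constant `Bc` below (it must dominate the polymer norm of the localized power pieces,
✓`…PortS1LocPowSeries.norm_powMemberPiece_le`), localizes the power members itself (✓`…LocPowExpansion` ∕ `…LocPowPolymer` ∕ `…LocPowSeries`) and needs, for the resolvent member `½∫₀^R Tr (x + T)⁻¹ dx`,
exactly the pieces below; the x-integral's holomorphy is ✓`Literature.Analysis.Complex.differentiableOn_integral_of_dominated`, which is why (g2)(g3)(g5) are asked on an OPEN set, x-uniformly on `[0, ∞)`.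
* `G3CPiecesAt F Mc k a₀ ε₂₉ α₀ α₁ κt Bc TC EG EGZ` — (g1) `Σ_X EG x n X φ_B = Tr (x·1 + T_n(φ_B))⁻¹` eventually in `B`, every `x ≥ 0` (`T_n` = non-b₀ block of `TC n`); (g2)(g3)(g5) on an open
  `O ⊇` record space of `X`: `DifferentiableOn ℂ`, `‖EG x n X φ‖ ≤ Bc·#X·e^{−κt·dj X}` x-UNIFORM, `ContinuousOn x (Ici 0)`; (g4) (1.7) locality; (g6) (1.19)-type invariance under the (1.10) action; (gZ) ONE
  `IsLocal` ∕ `IsGaugeInv` integer formula `EGZ x` whose pull-back pieces are the `EG x n X` off the centred wrap class.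
* `G3CAtRecord F := ∀ κt > 0, ∀ c₀ γ₀ γ₁, ∃ δG Mth', ∀ δ₀ ≥ δG, ∀ Mc ≥ Mth', McGuard → ∃ Bc ≥ 0, ∀ a₀ α₀ α₁ ε₂₉ k carriers, P0CarrierClauses … → ∃ EG EGZ, G3CPiecesAt …` — the TARGET rate `κt`
  is demanded («κ can be arbitrarily large if M is sufficiently large», [16] p.262), the thresholds `δG, Mth'` are `a₀`-free (◆ G-1: they must instantiate into `PortRecordLZdetHalf`'s `∃ Mth` before
  `∀ a₀`), `Bc` is fixed after `Mc` and before `k` and the carriers (k-, volume-, carrier-uniform).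

HONEST FRAMING.  DISPLAYED statements (Prop-valued definitions), asserted for nothing, inhabited NOWHERE: `G3CAtRecord` is the complex ∕ field-localised ∕ torus edition of [B4] (5.17) + [B9] (3.90) + [16]
p.272 «G̃₃(x) has the same properties as G̃₂» — the tree holds the real unit-lattice mechanism (✓`B4Sect5CubeBounds.hasSum517_lattice'`) and the resummation algebra (✓`B10LogDet63` §3), NOT this edition
(located genuine gap G-P6, N∕B9 lane); nothing of Bałaban asserted, ported or discharged; `stub_P0C` ∕ `stub_G3C` ∕ `stub_FE` OPEN; 27930 OPEN (stubs 2∕4 by name) · no claim; K0ᴬ ∕ K1ᴬ ∕ K3ᴬ OPEN; NODE O 0∕1;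
COUNT 8∕28 · K 1∕4 UNMOVED; finite `𝕋⁴_{L^K}` at fixed ε — NOT continuum ∕ OS ∕ Clay; **the Yang–Mills mass gap is NOT proved by any of this.**  No `sorry`, no `instance`, no `notation`; standard axioms.
-/

noncomputable section

open scoped BigOperators Matrix.Norms.L2Operator Topology
open Filter

namespace Summit.QuantumFields.YangMills.Theorems.BalabanUVNodesPortS1

open Summit.QuantumFields.YangMills.Theorems.K0RecordFormatNames
open Literature.MathematicalPhysics.QuantumFieldTheory.Balaban1983to89
open Literature.MathematicalPhysics.QuantumFieldTheory.Balaban1983to89.Node00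
open Literature.MathematicalPhysics.QuantumFieldTheory.Balaban1983to89.T4Continuum (T4Family)

/-- ★ **`G3CPiecesAt` — WHAT THE RESOLVENT MEMBER OF (63) MUST COME WITH** (the resummed form (24)–(25) of the generalized random walk expansion of `Tr (x + T)⁻¹`, [16] p.262∕p.272,
at the record's complex carrier `TC`; the glue integrates `x` over the FINITE interval `[0, R]` of ✓`B10LogDet63.matrix63`, `R = 2γ₁'` chosen after `Bc`, so the clauses are asked x-UNIFORMLY on `[0, ∞)` and no decay in `x` is needed): pieces `EG x n X φ` with (g1) `Σ_X EG x n X φ_B = Tr (x·1 + T_n(φ_B))⁻¹` eventually in `B`, for every `x ≥ 0` (`T_n` = the non-b₀ block of `TC n`);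
(g2)–(g5) on an OPEN set `O ⊇` the record space of `X`, for every `x ≥ 0`: holomorphy in the pair, the bound `Bc·#X·e^{−κt·dj X}` (x-UNIFORM), continuity in `x` on `[0, ∞)`; (g4) (1.7)
locality; (g6) invariance under the (1.10) action of every units-valued `u`; (gZ) ONE local, `SL(2,ℂ)`-invariant integer formula `EGZ x` whose pull-back pieces are the `EG x n X` off the
centred wrap class.  DISPLAYED; inhabited nowhere. [cite: Balaban1985UV3, (23)–(25) p.262, (63) p.272; Balaban1985BackgroundPropagators, (3.90) p.409; Balaban1987RG1, (1.7) p.261, (1.18)–(1.19) p.263, (1.21) p.264] -/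
def G3CPiecesAt (F : T4Family) (Mc k : ℕ) (a₀ ε₂₉ α₀ α₁ κt Bc : ℝ)
    (TC : (n : ℕ) → Sect2.CPair (F.P (recordK₀ F Mc k + n)) (MatA 2) →
        FluctIdx F k (recordK₀ F Mc k + n) → FluctIdx F k (recordK₀ F Mc k + n) → ℂ)
    (EG : ℝ → (n : ℕ) → (recordDomSys F Mc k (recordK₀ F Mc k + n)).Dom → Sect2.CPair (F.P (recordK₀ F Mc k + n)) (MatA 2) → ℂ)
    (EGZ : ℝ → IntFormula) : Prop :=
  letI θ := thetaFill F a₀ ε₂₉; letI := θ.instVβ₁; letI := θ.instVβ₂; letI := θ.instιβ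
  -- (g1) the resummed representation of the resolvent trace at the record's real points, x-pointwise on [0, ∞)
  (∀ n : ℕ, ∀ᶠ B in 𝓝 (0 : recordW F a₀ ε₂₉ k (recordK₀ F Mc k + n)), ∀ x : ℝ, 0 ≤ x →
    ∑ X : (recordDomSys F Mc k (recordK₀ F Mc k + n)).Dom, EG x n X (recordPairJ F θ k (recordK₀ F Mc k + n) B) =
      ((x : ℂ) • (1 : Matrix (NonB0Idx F k (recordK₀ F Mc k + n)) (NonB0Idx F k (recordK₀ F Mc k + n)) ℂ) +
        Matrix.of (fun i j : NonB0Idx F k (recordK₀ F Mc k + n) => TC n (recordPairJ F θ k (recordK₀ F Mc k + n) B) i.1 j.1))⁻¹.trace) ∧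
  -- (g2)(g3)(g5) on an open set containing the record space of X: holomorphy, the x-uniform (1.18)-type bound, continuity in x
  (∀ (n : ℕ) (X : (recordDomSys F Mc k (recordK₀ F Mc k + n)).Dom), ∃ O : Set (Sect2.CPair (F.P (recordK₀ F Mc k + n)) (MatA 2)),
    IsOpen O ∧
    {φ | encodeCfg F (recordK₀ F Mc k + n) φ ∈ recordUc F Mc k α₀ α₁ (recordK₀ F Mc k + n) X} ⊆ O ∧
    (∀ x : ℝ, 0 ≤ x → DifferentiableOn ℂ (fun φ => EG x n X φ) O ∧
      ∀ φ ∈ O, ‖EG x n X φ‖ ≤ Bc * ((X.1 : Finset _).card : ℝ) * Real.exp (-(κt * (recordDomSys F Mc k (recordK₀ F Mc k + n)).dj X))) ∧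
    (∀ φ ∈ O, ContinuousOn (fun x : ℝ => EG x n X φ) (Set.Ici 0))) ∧
  -- (g4) (1.7) locality
  (∀ (x : ℝ) (n : ℕ) (X : (recordDomSys F Mc k (recordK₀ F Mc k + n)).Dom) (φ ψ : Sect2.CPair (F.P (recordK₀ F Mc k + n)) (MatA 2)),
    Sect2.agreeOnSet (Sect2.domSites (F.P (recordK₀ F Mc k + n)) Mc (k + 1) X) φ ψ → EG x n X φ = EG x n X ψ) ∧
  -- (g6) invariance under the (1.10) action
  (∀ (x : ℝ) (n : ℕ) (X : (recordDomSys F Mc k (recordK₀ F Mc k + n)).Dom) (u : Site (F.P (recordK₀ F Mc k + n)) 0 → (MatA 2)ˣ)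
      (φ : Sect2.CPair (F.P (recordK₀ F Mc k + n)) (MatA 2)), EG x n X (Sect2.cAct u φ) = EG x n X φ) ∧
  -- (gZ) one integer formula for all volumes, off the centred wrap class
  (∀ x : ℝ, 0 ≤ x → (EGZ x).IsLocal (F.L ^ (k + 1) * Mc) ∧ (EGZ x).IsGaugeInv ∧
    ∀ (n : ℕ) (X : (recordDomSys F Mc k (recordK₀ F Mc k + n)).Dom), X ∉ recordWrapCtr F Mc k (recordK₀ F Mc k + n) →
      ∀ φ, (EGZ x).piece F Mc k (recordK₀ F Mc k + n) X φ = EG x n X φ)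

/-- ★★ **`G3CAtRecord F` — THE LOCATED GAP G-P6 AS A UNIVERSAL LETTER**: every carrier satisfying the P0-ℂ body with decay rate `δ₀ ≥ δG` at cube size `Mc ≥ Mth'` has the resolvent
pieces `G3CPiecesAt … κt Bc …` with the TARGET rate `κt` («κ can be arbitrarily large if M is sufficiently large», [16] p.262); the complex ∕ field-localised ∕ torus edition of [B4] (5.17) +
[B9] (3.90) + [16] p.272 «G̃₃(x) has the same properties as G̃₂».  DISPLAYED; inhabited nowhere. [cite: Balaban1985UV3, (23)–(25) p.262, (63) p.272; Balaban1985BackgroundPropagators, (3.90) p.409;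
Balaban1984PropagatorsI, (5.17) p.40] -/
def G3CAtRecord (F : T4Family) : Prop :=
  ∀ κt : ℝ, 0 < κt →
  ∀ c₀ γ₀ γ₁ : ℝ, 0 < c₀ → 0 < γ₀ → γ₀ ≤ γ₁ →
  ∃ δG : ℝ, 0 < δG ∧ ∃ Mth' : ℕ,
  ∀ δ₀ : ℝ, δG ≤ δ₀ → ∀ Mc : ℕ, Mth' ≤ Mc → McGuard F Mc →
  ∃ Bc : ℝ, 0 ≤ Bc ∧
  ∀ a₀ α₀ α₁ ε₂₉ : ℝ, 0 < a₀ → 0 < α₀ → 0 < α₁ → 0 < ε₂₉ → ∀ (k : ℕ) TC TY TZY AdM AdZ,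
    P0CarrierClauses F a₀ δ₀ c₀ γ₀ γ₁ Mc α₀ α₁ ε₂₉ k TC TY TZY AdM AdZ →
    ∃ EG EGZ, G3CPiecesAt F Mc k a₀ ε₂₉ α₀ α₁ κt Bc TC EG EGZ

end Summit.QuantumFields.YangMills.Theorems.BalabanUVNodesPortS1

end
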